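/-
Copyright (c) 2026 the pub-hodgecm-mathlib formalisation cell (harness21).  Prover seat hodgecm-mathlib-K2E3-p21 (g6), Track B «K2-LIT» ∕ h413
(`stmt-HodgeConjecture-24833`), line `K2_E3_EllipticInputs`, road «GL₂-sc» (road owner K2E5-p17 (g5), ASSIGNMENTS 2026-09-04T09:19:45Z; dealer K2E3-plan (g4) D66;
BRICK LIST v1.1), brick (2E-c) = the `N = 2` twin of ★ (B3) §4 `K2E3GL3ModCocompactEllPackage.exists_ellWeight_quotScalar` (K2E3-p23 (g5)), HYPOTHESIS-FIRST on the head of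
(2E-b2) `K2E3GL2FinConjModCocompact` (K2E3-p11 (g6)).  2026-09-04.
-/
import Summits.HodgeConjecture.HodgeConjecture.Theorems.K2E3GL3ModCocompactEllPackage    -- ★ (B3) p857797-era (K2E3-p23 (g5)): GENERIC §3 `exists_ellWeight_of_finConj_cc` (any unimodular lcsc Hausdorff group)
import Summits.HodgeConjecture.HodgeConjecture.Theorems.K2E3GL2ModCocompactUnimodular    -- ★ (2F-b′) (K2E5-p17 (g5)): `isMulRightInvariant_quotScalar_of_isHaarMeasure`; brings ★ (2F-b) `t2Space_quotScalar`, ★ (2F-a) `secondCountableTopology_gl2`, `locallyCompactSpace_gl2`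
import Summits.HodgeConjecture.HodgeConjecture.Theorems.K2E3GL2FinConjModCocompact      -- ★ (2E-b2) p858941 (K2E3-p11 (g6)): `finConjModCocompact_cc` — (FC) at `G_Λ` from (FC) on `Ḡ = GL₂(F) ⧸ Z` (binder `hcc`)
import HarnessLib

/-!
# Crux `H413` — K2-LIT E3, road «GL₂-sc», brick (2E-c): the ELLIPTIC-SET package of the truncated-character domination at `G_Λ = GL₂(F) ⧸ Λ·1`, from the
# finite-conjugation estimate (FC) over the compact-centraliser domain — almost-everywhere form, hypothesis-first

Cell `hodgecm-mathlib`, Track B, line `K2_E3_EllipticInputs`, road «GL₂-sc» = Harish-Chandra's local integrability for supercuspidal `GL₂(F)` (letter (S-C′-GL₂sc) of the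
hosted leaf (nsc-S-C′); road owner K2E5-p17 (g5); BRICK LIST v1.1 `K2/K2E5-p17/g5/BRICKLIST-GL2sc-v1.1.K2E5-p17-g5.md`).  Harish-Chandra's domination of the truncated
orbital integrals `Θ_n(g) = ∫_{Ω n} θ(x g x⁻¹) dx` of a compactly supported continuous `θ` (a supercuspidal coefficient) splits `G_Λ` into the elements with COMPACT
centraliser (the elliptic set) and the rest.  ★ (B3) §3 `exists_ellWeight_of_finConj_cc` (K2E3-p23 (g5)) is GENERIC: for any unimodular, locally compact, Hausdorff,
second-countable group in which (FC) holds over the compact-centraliser domain, it returns the elliptic weight `W_E ∈ L¹_loc`, the compactness of the fibres over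
`tsupport θ`, and the localisation ∕ convergence ∕ ball bound of the truncated orbital integrals a.e. on the elliptic set.  This file is its instance at
`G_Λ = GL₂(F) ⧸ Λ·1` (`Λ ≤ F^×` closed), with (FC) — the head `finConjModCocompact_cc` of (2E-b2) `K2E3GL2FinConjModCocompact` (K2E3-p11 (g6), twin of ★ (B1)) — taken
as the HYPOTHESIS `hFC` at fixed `F, ϖ, Λ, μ` (road owner's «hypothesis-first so all run in parallel»); the frame facts are ★ (2F-a) (`GL₂(F)` second countable, locally
compact), ★ (2F-b) (`G_Λ` Hausdorff) and ★ (2F-b′) (`G_Λ` unimodular).  THEOREMS ONLY; count-neutral helper (`--supports stmt-HodgeConjecture-24833 --as helper`).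

* **`exists_ellWeight_quotScalar_of_finConj_cc`** — for a Haar measure `μ` on `G_Λ`, (FC) over the compact-centraliser domain (`hFC`), `θ ∈ C_c(G_Λ, ℂ)` and a compact
  exhaustion `Ω`: a weight `W_E ∈ L¹_loc(μ)`, `W_E ≥ 0`, such that for a.e. `g` with compact centraliser the fibre `{x | xgx⁻¹ ∈ tsupport θ}` is compact, lies in some
  `Ω R`, `∫_{Ω n} θ(xgx⁻¹) = ∫_{Ω n ∩ Ω R} θ(xgx⁻¹)` for all `n`, the truncated orbital integrals CONVERGE (eventually constant) to `∫_{Ω R} θ(xgx⁻¹) = ∫ θ(xgx⁻¹)`, and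
  `∫_{Ω R} ‖θ(xgx⁻¹)‖ ≤ W_E(g)` — the `hcancE` ∕ `hballE` ∕ elliptic `hlim` inputs of (2A-1) `K2E3GL2ModCocompactCharLocInt` (twin of ★ B6-core).  When (2E-b2) is ★ the
  (FC) at `G_Λ` is supplied, the body of §2 is the one-line instance.
* **`exists_ellWeight_quotScalar_of_finConjGL_cc`** (§2) — the same with (FC) at `G_Λ` DISCHARGED by ★ (2E-b2) `finConjModCocompact_cc` from Harish-Chandra's finiteness
  on `Ḡ = GL₂(F) ⧸ Z` (binder `hcc`, ★ (2E-b2)'s shape verbatim = the head of (2E-b1) ∘ (2E-a5): ∀ Borel structure and Haar measure `ν` on `Ḡ`), for `Λ` closed AND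
  cocompact.

HONEST LABEL: HC_CM is proved only modulo the 7 printed citations (2 remaining named inputs: hLiu418 = stmt-HodgeConjecture-24832, h413 =
stmt-HodgeConjecture-24833) until rung 0 closes; count-neutral; the (FC) input on `Ḡ` is (2E-a5) `K2E3GL2FinConj` (K2E3-p17 (g8)), NOT here.

## References
* [HarishChandra1970] Harish-Chandra (notes by G. van Dijk), *Harmonic Analysis on Reductive p-adic Groups*, LNM 162 (1970), Part V §4 Lemma 22 p. 48, Part VI §8
  Theorem 14 p. 60, Part VII §3 pp. 70–73 (the elliptic half of the domination).
* [Folland1995] G. B. Folland, *A Course in Abstract Harmonic Analysis* (1995), §2.2, §2.4 (Haar measure, unimodular groups).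
* [Rogawski1990] J. Rogawski, *Automorphic Representations of Unitary Groups in Three Variables* (1990), §12.5 p. 182.
-/

open MeasureTheory MeasureTheory.Measure Set Function Filter
open scoped NNReal ENNReal MatrixGroups Pointwise WithZero Valued Topology
open Matrix
open Literature.NumberTheory.Automorphic Literature.NumberTheory.GaloisRepresentations Literature.NumberTheory.GaloisRepresentations.IsNonarchimedeanLocalField
open Summit.HodgeConjecture.HodgeConjecture.Cruxes.H413.K2E3GL2ModCentre Summit.HodgeConjecture.HodgeConjecture.Cruxes.H413.K2E3GL2ModCocompactCentral
open Summit.HodgeConjecture.HodgeConjecture.Cruxes.H413.K2E3GL3ModCocompactEllPackage (exists_ellWeight_of_finConj_cc)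
open Summit.HodgeConjecture.HodgeConjecture.Cruxes.H413.K2E3GL2FinConjModCocompact (finConjModCocompact_cc)

set_option autoImplicit false
-- the mandated namespace repeats `HodgeConjecture.HodgeConjecture`, as in every `Theorems/*.lean` of this sub-problem
set_option linter.dupNamespace false

noncomputable section

namespace Summit.HodgeConjecture.HodgeConjecture.Cruxes.H413.K2E3GL2ModCocompactEllPackage

/-! ## §1 Hypothesis-first on (FC) at `G_Λ` -/

/-- **(2E-c) THE ELLIPTIC PACKAGE AT `G_Λ = GL₂(F) ⧸ Λ·1`, HYPOTHESIS-FIRST ON (FC) AT `G_Λ`.**  For `Λ ≤ F^×` closed, a Haar measure `μ` on `G_Λ = GL₂(F) ⧸ Λ·1`, the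
finite-conjugation estimate `hFC` over the compact-centraliser domain (the head of (2E-b2) at this `μ`: for every compact `C` and every compactly supported bounded
`β : G_Λ → ℝ≥0∞`, `∫⁻_{C ∩ {Z(h) compact}} ∫⁻ β(xgx⁻¹) dμ dμ < ⊤`), `θ ∈ C_c(G_Λ, ℂ)` and a compact exhaustion `Ω` of `G_Λ`: the weight `W_E ∈ L¹_loc(μ)`, `W_E ≥ 0`, and
for a.e. `g` with compact centraliser the compactness of the fibre over `tsupport θ` and the localisation ∕ convergence ∕ ball bound of the truncated orbital integrals
`∫_{Ω n} θ(xgx⁻¹) dμ` — ★ (B3) §3 `exists_ellWeight_of_finConj_cc` at `G_Λ` over ★ (2F-a), ★ (2F-b) `t2Space_quotScalar`, ★ (2F-b′)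
`isMulRightInvariant_quotScalar_of_isHaarMeasure`.  These are the `hcancE`, `hballE` and elliptic-`hlim` inputs of (2A-1) on road «GL₂-sc».
[cite: HarishChandra1970, Part VII §3 p. 72] [cite: Rogawski1990, §12.5 p. 182] [cite: Folland1995, §2.4] -/
theorem exists_ellWeight_quotScalar_of_finConj_cc {F : Type*} [Field F] [Valued F ℤᵐ⁰] [ValuativeRel F] [(Valued.v : Valuation F ℤᵐ⁰).Compatible]
    [IsNonarchimedeanLocalField F] {ϖ : F} (hϖ : Valued.v ϖ = WithZero.exp (-1 : ℤ))
    (Λ₀ : Subgroup Fˣ) [(Λ₀.map (Matrix.GeneralLinearGroup.scalar (Fin 2))).Normal] (hΛ : IsClosed (Λ₀ : Set Fˣ))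
    [MeasurableSpace (GL (Fin 2) F ⧸ Λ₀.map (Matrix.GeneralLinearGroup.scalar (Fin 2)))] [BorelSpace (GL (Fin 2) F ⧸ Λ₀.map (Matrix.GeneralLinearGroup.scalar (Fin 2)))]
    (μ : Measure (GL (Fin 2) F ⧸ Λ₀.map (Matrix.GeneralLinearGroup.scalar (Fin 2)))) [μ.IsHaarMeasure]
    (hFC : ∀ {C : Set (GL (Fin 2) F ⧸ Λ₀.map (Matrix.GeneralLinearGroup.scalar (Fin 2)))}, IsCompact C →
      ∀ {β : (GL (Fin 2) F ⧸ Λ₀.map (Matrix.GeneralLinearGroup.scalar (Fin 2))) → ℝ≥0∞}, IsCompact (tsupport β) →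
      ∀ {Mb : ℝ≥0∞}, Mb ≠ ⊤ → (∀ g, β g ≤ Mb) →
        ∫⁻ g in C ∩ {h : GL (Fin 2) F ⧸ Λ₀.map (Matrix.GeneralLinearGroup.scalar (Fin 2)) |
            IsCompact ((Subgroup.centralizer ({h} : Set (GL (Fin 2) F ⧸ Λ₀.map (Matrix.GeneralLinearGroup.scalar (Fin 2))))) :
              Set (GL (Fin 2) F ⧸ Λ₀.map (Matrix.GeneralLinearGroup.scalar (Fin 2))))},
          ∫⁻ x, β (x * g * x⁻¹) ∂μ ∂μ < ⊤)
    {θ : (GL (Fin 2) F ⧸ Λ₀.map (Matrix.GeneralLinearGroup.scalar (Fin 2))) → ℂ} (hθ : Continuous θ) (hθs : HasCompactSupport θ)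
    (Ω : CompactExhaustion (GL (Fin 2) F ⧸ Λ₀.map (Matrix.GeneralLinearGroup.scalar (Fin 2)))) :
    ∃ W_E : (GL (Fin 2) F ⧸ Λ₀.map (Matrix.GeneralLinearGroup.scalar (Fin 2))) → ℝ, LocallyIntegrable W_E μ ∧ (∀ g, 0 ≤ W_E g) ∧
      ∀ᵐ g ∂μ, IsCompact ((Subgroup.centralizer ({g} : Set (GL (Fin 2) F ⧸ Λ₀.map (Matrix.GeneralLinearGroup.scalar (Fin 2))))) :
          Set (GL (Fin 2) F ⧸ Λ₀.map (Matrix.GeneralLinearGroup.scalar (Fin 2)))) →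
        IsCompact {x : GL (Fin 2) F ⧸ Λ₀.map (Matrix.GeneralLinearGroup.scalar (Fin 2)) | x * g * x⁻¹ ∈ tsupport θ} ∧
        ∃ R : ℕ, {x : GL (Fin 2) F ⧸ Λ₀.map (Matrix.GeneralLinearGroup.scalar (Fin 2)) | x * g * x⁻¹ ∈ tsupport θ} ⊆ Ω R ∧
          (∀ n : ℕ, ∫ x in Ω n, θ (x * g * x⁻¹) ∂μ = ∫ x in Ω n ∩ Ω R, θ (x * g * x⁻¹) ∂μ) ∧
          Tendsto (fun n : ℕ => ∫ x in Ω n, θ (x * g * x⁻¹) ∂μ) atTop (𝓝 (∫ x in Ω R, θ (x * g * x⁻¹) ∂μ)) ∧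
          (∫ x in Ω R, θ (x * g * x⁻¹) ∂μ = ∫ x, θ (x * g * x⁻¹) ∂μ) ∧
          ∫ x in Ω R, ‖θ (x * g * x⁻¹)‖ ∂μ ≤ W_E g := by
  haveI : SecondCountableTopology (GL (Fin 2) F) := secondCountableTopology_gl2 F
  haveI : LocallyCompactSpace (GL (Fin 2) F) := locallyCompactSpace_gl2 F
  haveI : T2Space (GL (Fin 2) F ⧸ Λ₀.map (Matrix.GeneralLinearGroup.scalar (Fin 2))) := t2Space_quotScalar Λ₀ hΛ
  haveI : μ.IsMulRightInvariant := K2E3GL2ModCocompactUnimodular.isMulRightInvariant_quotScalar_of_isHaarMeasure Λ₀ hΛ hϖ μ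
  exact exists_ellWeight_of_finConj_cc μ (fun hC _ _ hβs _ hMb hβM => hFC hC hβs hMb hβM) hθ hθs Ω


/-! ## §2 (FC) at `G_Λ` discharged by ★ (2E-b2): hypothesis-first on Harish-Chandra's finiteness on `Ḡ = GL₂(F) ⧸ Z` -/

/-- **(2E-c) THE ELLIPTIC PACKAGE AT `G_Λ`, FROM (FC) ON `Ḡ = GL₂(F) ⧸ Z`.**  For `Λ ≤ F^×` closed with `F^× ⧸ Λ` compact, a Haar measure `μ` on `G_Λ`, Harish-Chandra's
finiteness `hcc` of the conjugation-fibre integral over the compact-centraliser domain of `Ḡ` (for every Borel structure and Haar measure `ν` on `Ḡ`; the head of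
(2E-b1) ∘ (2E-a5)), `θ ∈ C_c(G_Λ, ℂ)` and a compact exhaustion `Ω`: the elliptic weight `W_E ∈ L¹_loc(μ)`, `W_E ≥ 0`, and the a.e. localisation ∕ convergence ∕ ball
bound of the truncated orbital integrals on the elliptic set — §1 over ★ (2E-b2) `finConjModCocompact_cc` (the passage `Ḡ ← G_Λ`: square roots of unity).
[cite: HarishChandra1970, Part VII §3 p. 72] [cite: Rogawski1990, §12.5 p. 182] -/
theorem exists_ellWeight_quotScalar_of_finConjGL_cc {F : Type*} [Field F] [Valued F ℤᵐ⁰] [ValuativeRel F] [(Valued.v : Valuation F ℤᵐ⁰).Compatible]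
    [IsNonarchimedeanLocalField F] {ϖ : F} (hϖ : Valued.v ϖ = WithZero.exp (-1 : ℤ))
    (hcc : ∀ [MeasurableSpace (GL (Fin 2) F ⧸ Subgroup.center (GL (Fin 2) F))] [BorelSpace (GL (Fin 2) F ⧸ Subgroup.center (GL (Fin 2) F))]
      (ν : Measure (GL (Fin 2) F ⧸ Subgroup.center (GL (Fin 2) F))) [ν.IsHaarMeasure]
      {C : Set (GL (Fin 2) F ⧸ Subgroup.center (GL (Fin 2) F))}, IsCompact C →
      ∀ {β : (GL (Fin 2) F ⧸ Subgroup.center (GL (Fin 2) F)) → ℝ≥0∞}, Continuous β → IsCompact (tsupport β) →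
      ∀ {Mb : ℝ≥0∞}, Mb ≠ ⊤ → (∀ g, β g ≤ Mb) →
      ∫⁻ g in C ∩ {h : GL (Fin 2) F ⧸ Subgroup.center (GL (Fin 2) F) | IsCompact ((Subgroup.centralizer ({h} : Set (GL (Fin 2) F ⧸ Subgroup.center (GL (Fin 2) F)))) :
          Set (GL (Fin 2) F ⧸ Subgroup.center (GL (Fin 2) F)))}, ∫⁻ x, β (x * g * x⁻¹) ∂ν ∂ν < ⊤)
    (Λ₀ : Subgroup Fˣ) [(Λ₀.map (Matrix.GeneralLinearGroup.scalar (Fin 2))).Normal] (hΛ : IsClosed (Λ₀ : Set Fˣ)) [CompactSpace (Fˣ ⧸ Λ₀)]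
    [MeasurableSpace (GL (Fin 2) F ⧸ Λ₀.map (Matrix.GeneralLinearGroup.scalar (Fin 2)))] [BorelSpace (GL (Fin 2) F ⧸ Λ₀.map (Matrix.GeneralLinearGroup.scalar (Fin 2)))]
    (μ : Measure (GL (Fin 2) F ⧸ Λ₀.map (Matrix.GeneralLinearGroup.scalar (Fin 2)))) [μ.IsHaarMeasure]
    {θ : (GL (Fin 2) F ⧸ Λ₀.map (Matrix.GeneralLinearGroup.scalar (Fin 2))) → ℂ} (hθ : Continuous θ) (hθs : HasCompactSupport θ)
    (Ω : CompactExhaustion (GL (Fin 2) F ⧸ Λ₀.map (Matrix.GeneralLinearGroup.scalar (Fin 2)))) :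
    ∃ W_E : (GL (Fin 2) F ⧸ Λ₀.map (Matrix.GeneralLinearGroup.scalar (Fin 2))) → ℝ, LocallyIntegrable W_E μ ∧ (∀ g, 0 ≤ W_E g) ∧
      ∀ᵐ g ∂μ, IsCompact ((Subgroup.centralizer ({g} : Set (GL (Fin 2) F ⧸ Λ₀.map (Matrix.GeneralLinearGroup.scalar (Fin 2))))) :
          Set (GL (Fin 2) F ⧸ Λ₀.map (Matrix.GeneralLinearGroup.scalar (Fin 2)))) →
        IsCompact {x : GL (Fin 2) F ⧸ Λ₀.map (Matrix.GeneralLinearGroup.scalar (Fin 2)) | x * g * x⁻¹ ∈ tsupport θ} ∧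
        ∃ R : ℕ, {x : GL (Fin 2) F ⧸ Λ₀.map (Matrix.GeneralLinearGroup.scalar (Fin 2)) | x * g * x⁻¹ ∈ tsupport θ} ⊆ Ω R ∧
          (∀ n : ℕ, ∫ x in Ω n, θ (x * g * x⁻¹) ∂μ = ∫ x in Ω n ∩ Ω R, θ (x * g * x⁻¹) ∂μ) ∧
          Tendsto (fun n : ℕ => ∫ x in Ω n, θ (x * g * x⁻¹) ∂μ) atTop (𝓝 (∫ x in Ω R, θ (x * g * x⁻¹) ∂μ)) ∧
          (∫ x in Ω R, θ (x * g * x⁻¹) ∂μ = ∫ x, θ (x * g * x⁻¹) ∂μ) ∧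
          ∫ x in Ω R, ‖θ (x * g * x⁻¹)‖ ∂μ ≤ W_E g :=
  exists_ellWeight_quotScalar_of_finConj_cc hϖ Λ₀ hΛ μ (fun hC _ hβs _ hMb hβM => finConjModCocompact_cc hcc Λ₀ μ hC hβs hMb hβM) hθ hθs Ω

end Summit.HodgeConjecture.HodgeConjecture.Cruxes.H413.K2E3GL2ModCocompactEllPackage

end
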